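import Mathlib
import HarnessLib
import Summits.Ventures.LatticeQCDFlow.Scoring.IMHAcceptanceRecordJumpReversible
import Summits.Ventures.LatticeQCDFlow.Scoring.PositiveKernelCrossCovariance
import Summits.Ventures.LatticeQCDFlow.Exactness.ApproxTrivializingSampler

/-!
# The IMH acceptance record VII: the jump chain as a Markov kernel — Doeblin with constant `ā`

HONEST FRAMING: exact (Metropolis-corrected) sampling algorithms for lattice gauge theory; figures
of merit are autocorrelation/cost numbers at stated couplings and volumes; no continuum-physics
claim.  This file is value-free (no number of ours appears) and nothing in it is cited as a fact.

NEW WORK (tree-internal): V/VI (`IMHAcceptanceRecordJump*`) wrote the law of two CONSECUTIVE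
ACCEPTED STATES of the flow-MCMC kernel `K = indepMH q w` as the form `Γ(f, g) = ∫ f · J g dπ`,
`(J g)(x) = ∫ a(x, y) g(y) q(dy)`, `a = min(1, w y / w x)`.  Here the normalised jump operator is
made a Mathlib `Kernel`, so the tree's ABSTRACT reversible / positive / Doeblin theorems
(`ReversibleKernelTauIntFloor`, `PositiveKernelCrossCovariance`, `DoeblinAutocorrelation`) apply to
the SEQUENCE OF ACCEPTED CONFIGURATIONS by instantiation:
* `imhJump q w x = α(x)⁻¹ · a(x, ·) q` (`α = imhAcceptMass`) is a Markov kernel with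
  `kop (imhJump q w) g = J g / α` (`kop_imhJump`); `imhTilt q w π = (∫ α dπ)⁻¹ · α π` is the tilt
  of III as a probability measure (`integral_imhTilt`: its means are the accepted-row means).
* `π = w q` ⇒ `imhJump` is `imhTilt`-REVERSIBLE (`imhJump_isReversible`), `imhTilt`-invariant, and
  a POSITIVE operator (`imhJump_kop_nonneg`, VI), so `0 ≤ autocov (imhJump q w) (imhTilt q w π) g t`
  at EVERY lag `t` (`autocov_imhJump_nonneg`; VI had lag one).
* **DOEBLIN BY ITS OWN INVARIANT LAW WITH CONSTANT `ā = ∫ α dπ`, FOR EVERY WEIGHT**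
  (`imhJump_doeblin`): `imhJump(x, ·) ≥ ā · imhTilt` for all `x`, from the pointwise bound
  `α(x) α(y) w(y) ≤ a(x, y)` (`Jump.mul_mul_le_imhAcceptE`; only `α w ≤ ∫ w dq = 1` and `α ≤ 1`
  enter).  Hence for bounded measurable accepted-row-centred `f`: `|autocov … f t| ≤ (1 − ā)ᵗ
  ∫ f² d(imhTilt)` (`abs_autocov_imhJump_le`) and `τ_int(jump chain, f) ≤ 1/ā − 1/2`
  (`tauInt_imhJump_le`) with NO floor or oscillation hypothesis on `w`: all non-geometric slowness
  of a heavy-weight independence sampler sits in the SOJOURNS (IV), never in the order of visits.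
* Path level (`hasSum_acceptedExit_prob_jump`): V's exit law reads
  `Σ_k P̂(Z_a ∈ S × {acc}, k rejections, Z_{a+1+k} ∈ S' × {acc}) = ∫_S α(x) imhJump(x, S') π(dx)`
  — the jump kernel IS the conditional law of the next accepted state; lattice instance
  `flowSampler_jump_doeblin` (every volume; `ā ≥ e^{−2δ}` from the Lüscher defect `δ`).

Printed counterparts, NAMED ONLY (not used, not cited as facts): the jump chain of a Metropolis
chain is Markov with stationary law `∝ α π` [corpus:paper:arxiv-1910.13316 p.4 Prop. 2, 5; p.6
(iv)]; for MH it is the chain of accepted states, with asymptotic-variance relations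
[corpus:paper:arxiv-1609.02541 p.12 Def. 4, Rem. 10; p.30 Prop. 28]; Douc–Robert's Lemma 1 (accepted
values form a Markov chain, kernel `α q / p`, geometric holding) [galaxy:pdf:-7173847574603489160
p.2].  NOT CLAIMED here: the `k`-step path law (`k`-th next accepted state ↔ `imhJump^k`);
every-start convergence (`Doeblin.doeblin_iterate_sub_invariant_le` applies to `imhJump_doeblin`,
not spelled out); a jump-chain/full-chain variance ranking; continuum statements.
-/

noncomputable section

namespace Summit.Ventures.LatticeQCDFlow.Scoring

open MeasureTheory ProbabilityTheory Filter Finset Summit.Ventures.LatticeQCDFlow.Exactness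
open scoped ENNReal Topology

variable {Ω : Type*} [MeasurableSpace Ω]

/-! ### §0 The jump kernel and the tilt -/

/-- **The jump kernel of the independence sampler**: from `x`, the law of the NEXT ACCEPTED
proposal, `J̃(x, dy) = a(x, y) q(dy) / α(x)`. -/
def imhJump (q : Measure Ω) [IsProbabilityMeasure q] (w : Ω → ℝ) : Kernel Ω Ω :=
  Kernel.withDensity (Kernel.const Ω q) fun x y => (imhAcceptMass q w x)⁻¹ * imhAcceptE w x y

/-- **The tilt as a measure**: `(∫ α dπ)⁻¹ · α π`, the equilibrium law of the accepted rows
(III). -/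
def imhTilt (q : Measure Ω) (w : Ω → ℝ) (π : Measure Ω) : Measure Ω :=
  (∫⁻ x, imhAcceptMass q w x ∂π)⁻¹ • π.withDensity (imhAcceptMass q w)

variable {q : Measure Ω} [IsProbabilityMeasure q] {w : Ω → ℝ} {π : Measure Ω}

/-- The local acceptance rate is finite. -/
theorem imhAcceptMass_ne_top (x : Ω) : imhAcceptMass q w x ≠ ⊤ :=
  ne_top_of_le_ne_top ENNReal.one_ne_top (imhAcceptMass_le_one q w x)

/-- The local acceptance rate is nonzero (positive weight). -/
theorem Jump.acceptMass_ne_zero_of_pos (hw : Measurable w) (hw0 : ∀ x, 0 < w x) (x : Ω) :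
    imhAcceptMass q w x ≠ 0 :=
  (ENNReal.toReal_pos_iff.1 (toReal_imhAcceptMass_pos (q := q) hw hw0 x)).1.ne'

/-- Set form: `J̃(x, B) = α(x)⁻¹ ∫_B a(x, y) q(dy)` (any set `B`). -/
theorem imhJump_apply' (hw : Measurable w) (x : Ω) (B : Set Ω) :
    imhJump q w x B = (imhAcceptMass q w x)⁻¹ * ∫⁻ y in B, imhAcceptE w x y ∂q := by
  have hm : Measurable (Function.uncurry fun x y => (imhAcceptMass q w x)⁻¹ * imhAcceptE w x y) :=
    ((measurable_imhAcceptMass q hw).comp measurable_fst).inv.mul (measurable_imhAcceptE hw)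
  rw [imhJump, Kernel.withDensity_apply' _ hm, Kernel.const_apply]
  exact lintegral_const_mul _ (measurable_imhAcceptE hw).of_uncurry_left

/-- Measure form: `J̃(x, ·) = α(x)⁻¹ • (a(x, ·) q)`. -/
theorem imhJump_apply (hw : Measurable w) (x : Ω) :
    imhJump q w x = (imhAcceptMass q w x)⁻¹ • q.withDensity (imhAcceptE w x) := by
  ext B hB
  rw [imhJump_apply' hw x B, Measure.smul_apply, smul_eq_mul, withDensity_apply _ hB]

/-- **The jump kernel is Markov** (`α(x) > 0`). -/
theorem isMarkovKernel_imhJump (hw : Measurable w) (hw0 : ∀ x, 0 < w x) :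
    IsMarkovKernel (imhJump q w) := by
  refine ⟨fun x => ⟨?_⟩⟩
  rw [imhJump_apply' hw x Set.univ, Measure.restrict_univ]
  exact ENNReal.inv_mul_cancel (Jump.acceptMass_ne_zero_of_pos hw hw0 x) (imhAcceptMass_ne_top x)

/-- Real set form: `J̃(x, S) = (∫_S a(x, y) q(dy)) / α(x)`. -/
theorem real_imhJump_apply (hw : Measurable w) (hw0 : ∀ x, 0 < w x) (x : Ω) (S : Set Ω) :
    (imhJump q w x).real S = (∫ y in S, imhAccept w x y ∂q) / (imhAcceptMass q w x).toReal := by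
  rw [measureReal_def, imhJump_apply' hw x S, ENNReal.toReal_mul, ENNReal.toReal_inv,
    inv_mul_eq_div, integral_eq_lintegral_of_nonneg_ae (ae_of_all _ (imhAccept_nonneg hw0 x))
      (measurable_imhAccept_right hw x).aestronglyMeasurable]
  rfl

/-- **`kop` of the jump kernel**: `kop J̃ g = (J g) / α` with `(J g)(x) = ∫ a(x, y) g(y) q(dy)`
(the written-out jump operator of V/VI). -/
theorem kop_imhJump (hw : Measurable w) (hw0 : ∀ x, 0 < w x) (g : Ω → ℝ) (x : Ω) :
    kop (imhJump q w) g x = (∫ y, imhAccept w x y * g y ∂q) / (imhAcceptMass q w x).toReal := by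
  have haE : Measurable (imhAcceptE w x) := (measurable_imhAcceptE hw).of_uncurry_left
  unfold kop
  rw [imhJump_apply hw x, integral_smul_measure,
    integral_withDensity_eq_integral_toReal_smul haE (ae_of_all _ fun y => ENNReal.ofReal_lt_top),
    ENNReal.toReal_inv, smul_eq_mul, inv_mul_eq_div]
  congr 1
  refine integral_congr_ae (ae_of_all _ fun y => ?_)
  show (imhAcceptE w x y).toReal • g y = imhAccept w x y * g y
  rw [imhAcceptE, ENNReal.toReal_ofReal (imhAccept_nonneg hw0 x y), smul_eq_mul]

/-- `∫ α dπ ≤ 1`. -/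
theorem lintegral_imhAcceptMass_le_one (π : Measure Ω) [IsProbabilityMeasure π] :
    ∫⁻ x, imhAcceptMass q w x ∂π ≤ 1 :=
  (lintegral_mono fun x => imhAcceptMass_le_one q w x).trans_eq
    (by rw [lintegral_const, measure_univ, mul_one])

/-- `∫ α dπ ≠ 0` for a probability law `π` (`α > 0` everywhere). -/
theorem lintegral_imhAcceptMass_ne_zero (hw : Measurable w) (hw0 : ∀ x, 0 < w x)
    [IsProbabilityMeasure π] : ∫⁻ x, imhAcceptMass q w x ∂π ≠ 0 := fun h => by
  have hae := (lintegral_eq_zero_iff (measurable_imhAcceptMass q hw)).1 h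
  have hF : ∀ᵐ x ∂π, False := hae.mono fun x hx => Jump.acceptMass_ne_zero_of_pos hw hw0 x hx
  exact IsProbabilityMeasure.ne_zero π (ae_eq_bot.1 (Filter.eventually_false_iff_eq_bot.1 hF))

/-- **The tilt is a probability measure.** -/
theorem isProbabilityMeasure_imhTilt (hw : Measurable w) (hw0 : ∀ x, 0 < w x)
    [IsProbabilityMeasure π] : IsProbabilityMeasure (imhTilt q w π) := by
  constructor
  rw [imhTilt, Measure.smul_apply, smul_eq_mul, withDensity_apply _ MeasurableSet.univ,
    Measure.restrict_univ]
  exact ENNReal.inv_mul_cancel (lintegral_imhAcceptMass_ne_zero hw hw0)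
    (ne_top_of_le_ne_top ENNReal.one_ne_top (lintegral_imhAcceptMass_le_one π))

/-- **Integration against the tilt**: `∫ G d(imhTilt) = (∫ α G dπ) / ā` — the accepted-row means of
III (`(∫⁻ α dπ).toReal = ∫ α dπ = ā = P̂(accept)`: `integral_toReal`, `integral_acceptFlag`). -/
theorem integral_imhTilt (hw : Measurable w) (π : Measure Ω) (G : Ω → ℝ) :
    ∫ x, G x ∂(imhTilt q w π)
      = ((∫⁻ x, imhAcceptMass q w x ∂π).toReal)⁻¹ * ∫ x, (imhAcceptMass q w x).toReal * G x ∂π := by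
  rw [imhTilt, integral_smul_measure, integral_withDensity_eq_integral_toReal_smul
    (measurable_imhAcceptMass q hw) (ae_of_all _ fun x => (imhAcceptMass_ne_top (q := q) x).lt_top),
    ENNReal.toReal_inv, smul_eq_mul]
  simp_rw [smul_eq_mul]

/-! ### §1 Reversibility, invariance and positivity of the jump kernel under the tilt -/

/-- The mass flow of the jump kernel under `α π`:
`∫_A J̃(x, B) d(α π) = ∫_A ∫_B a(x, y) q(dy) π(dx)` (the measure `Γ(A, B)` of V). -/
theorem setLIntegral_imhJump (hw : Measurable w) (hw0 : ∀ x, 0 < w x) {A B : Set Ω}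
    (hA : MeasurableSet A) (hB : MeasurableSet B) (π : Measure Ω) :
    ∫⁻ x in A, imhJump q w x B ∂(π.withDensity (imhAcceptMass q w))
      = ∫⁻ x in A, ∫⁻ y in B, imhAcceptE w x y ∂q ∂π := by
  rw [setLIntegral_withDensity_eq_setLIntegral_mul _ (measurable_imhAcceptMass q hw)
    (Kernel.measurable_coe _ hB) hA]
  refine lintegral_congr fun x => ?_
  rw [Pi.mul_apply, imhJump_apply' hw x B, ← mul_assoc, ENNReal.mul_inv_cancel
    (Jump.acceptMass_ne_zero_of_pos hw hw0 x) (imhAcceptMass_ne_top x), one_mul]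

/-- `Γ(A, B) = Γ(B, A)` for `π = w q`: `∫_A ∫_B a dq dπ = ∫_A ∫_B min(w x, w y) dq dq` is symmetric
(Tonelli; the `ℝ≥0∞` form of VI's `setIntegral_setIntegral_imhAccept_comm`). -/
theorem setLIntegral_setLIntegral_imhAcceptE_comm (hw : Measurable w) (hw0 : ∀ x, 0 < w x)
    (hπ : (q.withDensity fun x => ENNReal.ofReal (w x)) = π) {A B : Set Ω}
    (hA : MeasurableSet A) (hB : MeasurableSet B) :
    ∫⁻ x in A, ∫⁻ y in B, imhAcceptE w x y ∂q ∂π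
      = ∫⁻ x in B, ∫⁻ y in A, imhAcceptE w x y ∂q ∂π := by
  subst hπ
  have hs : Measurable (Function.uncurry fun x y : Ω => ENNReal.ofReal (min (w x) (w y))) :=
    ((hw.comp measurable_fst).min (hw.comp measurable_snd)).ennreal_ofReal
  have h1 : ∀ {S T : Set Ω}, MeasurableSet S →
      ∫⁻ x in S, ∫⁻ y in T, imhAcceptE w x y ∂q ∂(q.withDensity fun x => ENNReal.ofReal (w x))
        = ∫⁻ x in S, ∫⁻ y in T, ENNReal.ofReal (min (w x) (w y)) ∂q ∂q := fun {S T} hS => by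
    rw [setLIntegral_withDensity_eq_setLIntegral_mul _ hw.ennreal_ofReal
      (measurable_imhAcceptE hw).lintegral_prod_right hS]
    refine lintegral_congr fun x => ?_
    rw [Pi.mul_apply, ← lintegral_const_mul _ (measurable_imhAcceptE hw).of_uncurry_left]
    exact lintegral_congr fun y => ofReal_mul_imhAcceptE hw0 x y
  rw [h1 hA, h1 hB,
    lintegral_lintegral_swap (hs.aemeasurable (μ := (q.restrict A).prod (q.restrict B)))]
  exact lintegral_congr fun y => lintegral_congr fun x => by rw [min_comm]

/-- **THE JUMP KERNEL IS REVERSIBLE WITH RESPECT TO THE TILT** (`π = w q`; Mathlib's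
`Kernel.IsReversible`). -/
theorem imhJump_isReversible (hw : Measurable w) (hw0 : ∀ x, 0 < w x)
    (hπ : (q.withDensity fun x => ENNReal.ofReal (w x)) = π) :
    Kernel.IsReversible (imhJump q w) (imhTilt q w π) := by
  intro A B hA hB
  rw [imhTilt, Measure.restrict_smul, Measure.restrict_smul, lintegral_smul_measure,
    lintegral_smul_measure, setLIntegral_imhJump hw hw0 hA hB, setLIntegral_imhJump hw hw0 hB hA,
    setLIntegral_setLIntegral_imhAcceptE_comm hw hw0 hπ hA hB]

/-- **… hence the tilt is `J̃`-invariant** (VI's `hasSum_nextAccepted_prob` in kernel form). -/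
theorem imhJump_invariant (hw : Measurable w) (hw0 : ∀ x, 0 < w x)
    (hπ : (q.withDensity fun x => ENNReal.ofReal (w x)) = π) :
    Kernel.Invariant (imhJump q w) (imhTilt q w π) := by
  haveI := isMarkovKernel_imhJump (q := q) hw hw0
  exact (imhJump_isReversible hw hw0 hπ).invariant

/-- **Cross moments of the jump chain are VI's `Γ`**: `∫ f · kop J̃ g d(imhTilt) = Γ(f, g) / ā`. -/
theorem integral_mul_kop_imhJump (hw : Measurable w) (hw0 : ∀ x, 0 < w x) (π : Measure Ω)
    (f g : Ω → ℝ) :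
    ∫ x, f x * kop (imhJump q w) g x ∂(imhTilt q w π)
      = ((∫⁻ x, imhAcceptMass q w x ∂π).toReal)⁻¹
          * ∫ x, f x * ∫ y, imhAccept w x y * g y ∂q ∂π := by
  rw [integral_imhTilt hw]
  congr 1
  refine integral_congr_ae (ae_of_all _ fun x => ?_)
  have hα := (toReal_imhAcceptMass_pos (q := q) hw hw0 x).ne'
  beta_reduce
  rw [kop_imhJump hw hw0 g x, mul_div_assoc', mul_div_assoc', mul_div_cancel_left₀ _ hα]

/-- **THE JUMP KERNEL IS A POSITIVE OPERATOR ON `L²(imhTilt)`** (`π = w q`; bounded measurable `g`):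
`0 ≤ ∫ g · kop J̃ g d(imhTilt)` (VI's `integral_mul_integral_imhAccept_nonneg`). -/
theorem imhJump_kop_nonneg (hw : Measurable w) (hw0 : ∀ x, 0 < w x) [IsFiniteMeasure π]
    (hπ : (q.withDensity fun x => ENNReal.ofReal (w x)) = π) {g : Ω → ℝ} (hg : Measurable g)
    {C : ℝ} (hC : ∀ x, |g x| ≤ C) :
    0 ≤ ∫ x, g x * kop (imhJump q w) g x ∂(imhTilt q w π) := by
  rw [integral_mul_kop_imhJump hw hw0]
  exact mul_nonneg (inv_nonneg.2 ENNReal.toReal_nonneg)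
    (integral_mul_integral_imhAccept_nonneg hw hw0 hπ hg hC)

/-- **NONNEGATIVE AUTOCOVARIANCE OF THE JUMP CHAIN AT EVERY LAG** (`π = w q` a probability law;
bounded measurable `g`): `0 ≤ autocov J̃ imhTilt g t` for all `t` — consecutive, next-but-one, …
accepted measurements are all nonnegatively correlated in equilibrium (VI: lag one). -/
theorem autocov_imhJump_nonneg (hw : Measurable w) (hw0 : ∀ x, 0 < w x) [IsProbabilityMeasure π]
    (hπ : (q.withDensity fun x => ENNReal.ofReal (w x)) = π) {g : Ω → ℝ} (hg : Measurable g)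
    {B : ℝ} (hB : ∀ x, |g x| ≤ B) (t : ℕ) :
    0 ≤ autocov (imhJump q w) (imhTilt q w π) g t := by
  haveI := isMarkovKernel_imhJump (q := q) hw hw0
  haveI := isProbabilityMeasure_imhTilt (q := q) (π := π) hw hw0
  exact autocov_nonneg_of_kop_nonneg (imhJump_isReversible hw hw0 hπ)
    (fun g B hg hB => imhJump_kop_nonneg hw hw0 hπ hg hB) hg hB t

/-! ### §2 Doeblin with constant `ā`, unconditionally in the weight -/

/-- **The pointwise minorisation** (`∫ w dq = 1`): `α(x) · w(y) α(y) ≤ a(x, y)`, i.e.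
`min(w x, w y) ≥ (α w)(x) · (α w)(y)` (row 2's `Exactness.imhFlow_ge_rankOne`, pointwise) — only
`α w ≤ ∫ w dq = 1` and `α ≤ 1` are used. -/
theorem Jump.mul_mul_le_imhAcceptE (hw0 : ∀ x, 0 < w x)
    (hq1 : ∫⁻ y, ENNReal.ofReal (w y) ∂q = 1) (x y : Ω) :
    imhAcceptMass q w x * (ENNReal.ofReal (w y) * imhAcceptMass q w y) ≤ imhAcceptE w x y := by
  have hinv : ∀ z, imhAcceptMass q w z ≤ ENNReal.ofReal (w z)⁻¹ := fun z => by
    have h := imhAcceptMass_le (q := q) hw0 z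
    rwa [hq1, mul_one] at h
  have h1 : ENNReal.ofReal (w y) * imhAcceptMass q w y ≤ 1 :=
    calc ENNReal.ofReal (w y) * imhAcceptMass q w y
        ≤ ENNReal.ofReal (w y) * ENNReal.ofReal (w y)⁻¹ := mul_le_mul' le_rfl (hinv y)
      _ = 1 := by
          rw [← ENNReal.ofReal_mul (hw0 y).le, mul_inv_cancel₀ (hw0 y).ne', ENNReal.ofReal_one]
  have hle1 : imhAcceptMass q w x * (ENNReal.ofReal (w y) * imhAcceptMass q w y)
      ≤ ENNReal.ofReal 1 :=
    (mul_le_mul' (imhAcceptMass_le_one q w x) h1).trans_eq (by rw [one_mul, ENNReal.ofReal_one])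
  have hle2 : imhAcceptMass q w x * (ENNReal.ofReal (w y) * imhAcceptMass q w y)
      ≤ ENNReal.ofReal (w y / w x) :=
    calc _ ≤ ENNReal.ofReal (w x)⁻¹ * (ENNReal.ofReal (w y) * 1) :=
          mul_le_mul' (hinv x) (mul_le_mul' le_rfl (imhAcceptMass_le_one q w y))
      _ = ENNReal.ofReal (w y / w x) := by
          rw [mul_one, ← ENNReal.ofReal_mul (inv_nonneg.2 (hw0 x).le), inv_mul_eq_div]
  unfold imhAcceptE imhAccept
  rcases le_total 1 (w y / w x) with h | h
  · rwa [min_eq_left h]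
  · rwa [min_eq_right h]

/-- **DOEBLIN BY THE TILT WITH CONSTANT `ā`**: for `π = w q` a probability law, every state `x` and
every measurable `B`, `(∫ α dπ) · imhTilt(B) ≤ J̃(x, B)` — whatever the weight `w` (no floor, no
oscillation bound): the accepted-state chain is uniformly ergodic at rate `1 − ā`. -/
theorem imhJump_doeblin (hw : Measurable w) (hw0 : ∀ x, 0 < w x) [IsProbabilityMeasure π]
    (hπ : (q.withDensity fun x => ENNReal.ofReal (w x)) = π) (x : Ω) {B : Set Ω}
    (hB : MeasurableSet B) :
    (∫⁻ y, imhAcceptMass q w y ∂π) * imhTilt q w π B ≤ imhJump q w x B := by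
  have hq1 : ∫⁻ y, ENNReal.ofReal (w y) ∂q = 1 := by
    rw [← setLIntegral_univ, ← withDensity_apply _ MeasurableSet.univ, hπ, measure_univ]
  rw [imhTilt, Measure.smul_apply, smul_eq_mul, ← mul_assoc,
    ENNReal.mul_inv_cancel (lintegral_imhAcceptMass_ne_zero hw hw0)
      (ne_top_of_le_ne_top ENNReal.one_ne_top (lintegral_imhAcceptMass_le_one π)),
    one_mul, withDensity_apply _ hB, imhJump_apply' hw x B,
    ← lintegral_const_mul _ (measurable_imhAcceptE hw).of_uncurry_left]
  subst hπ
  rw [setLIntegral_withDensity_eq_setLIntegral_mul _ hw.ennreal_ofReal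
    (measurable_imhAcceptMass q hw) hB]
  refine lintegral_mono fun y => ?_
  rw [Pi.mul_apply, ← ENNReal.mul_le_iff_le_inv (Jump.acceptMass_ne_zero_of_pos hw hw0 x)
    (imhAcceptMass_ne_top x)]
  exact Jump.mul_mul_le_imhAcceptE hw0 hq1 x y

/-- **THE AUTOCORRELATION ENVELOPE OF THE JUMP CHAIN** (`π = w q`; bounded measurable `f` centred
on the accepted rows, `∫ α f dπ = 0`): `|autocov J̃ imhTilt f t| ≤ (1 − ā)ᵗ · ∫ f² d(imhTilt)` for
every `t` (`abs_autocov_le_of_doeblin`). -/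
theorem abs_autocov_imhJump_le (hw : Measurable w) (hw0 : ∀ x, 0 < w x) [IsProbabilityMeasure π]
    (hπ : (q.withDensity fun x => ENNReal.ofReal (w x)) = π) {f : Ω → ℝ} (hf : Measurable f)
    {C : ℝ} (hC : ∀ x, |f x| ≤ C) (hf0 : ∫ x, (imhAcceptMass q w x).toReal * f x ∂π = 0)
    (t : ℕ) :
    |autocov (imhJump q w) (imhTilt q w π) f t|
      ≤ (1 - (∫⁻ x, imhAcceptMass q w x ∂π).toReal) ^ t * ∫ x, f x ^ 2 ∂(imhTilt q w π) := by
  haveI := isMarkovKernel_imhJump (q := q) hw hw0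
  haveI := isProbabilityMeasure_imhTilt (q := q) (π := π) hw hw0
  exact abs_autocov_le_of_doeblin (imhJump_invariant hw hw0 hπ)
    (fun x B hB => imhJump_doeblin hw hw0 hπ x hB) hf hC
    (by rw [integral_imhTilt hw, hf0, mul_zero]) t

/-- **`τ_int` OF THE JUMP CHAIN IS AT MOST `1/ā − 1/2`** for every bounded measurable accepted-row-
centred observable (`π = w q`), on the tree's `Scoring.tauInt` (`tauInt_le_of_doeblin`). -/
theorem tauInt_imhJump_le (hw : Measurable w) (hw0 : ∀ x, 0 < w x) [IsProbabilityMeasure π]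
    (hπ : (q.withDensity fun x => ENNReal.ofReal (w x)) = π) {f : Ω → ℝ} (hf : Measurable f)
    {C : ℝ} (hC : ∀ x, |f x| ≤ C) (hf0 : ∫ x, (imhAcceptMass q w x).toReal * f x ∂π = 0) :
    tauInt (fun t => autocov (imhJump q w) (imhTilt q w π) f t
        / autocov (imhJump q w) (imhTilt q w π) f 0)
      ≤ 1 / (∫⁻ x, imhAcceptMass q w x ∂π).toReal - 1 / 2 := by
  haveI := isMarkovKernel_imhJump (q := q) hw hw0
  haveI := isProbabilityMeasure_imhTilt (q := q) (π := π) hw hw0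
  exact tauInt_le_of_doeblin (imhJump_invariant hw hw0 hπ)
    (fun x B hB => imhJump_doeblin hw hw0 hπ x hB)
    (pos_iff_ne_zero.2 (lintegral_imhAcceptMass_ne_zero hw hw0)) hf hC
    (by rw [integral_imhTilt hw, hf0, mul_zero])

/-! ### §3 Path level: the jump kernel is the conditional law of the next accepted state -/

/-- **V's exit law through the jump kernel** (`π K = π`; measurable `S, S'`; every time `a`):
`Σ_k P̂(Z_a ∈ S × {acc}, k rejections after a, Z_{a+1+k} ∈ S' × {acc}) = ∫_S α(x) J̃(x, S') π(dx)`
— given an accepted row at `x`, the next accepted state is `J̃(x, ·)`-distributed. -/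
theorem hasSum_acceptedExit_prob_jump [Fact (Measurable w)] [IsProbabilityMeasure π]
    (hw0 : ∀ x, 0 < w x) (hinv : Kernel.Invariant (indepMH q w) π) {S S' : Set Ω}
    (hS : MeasurableSet S) (hS' : MeasurableSet S') (a : ℕ) :
    HasSum (fun k => (imhRecordPath q w π).real {x | x a ∈ S ×ˢ ({true} : Set Bool) ∧
        (x (a + 1 + k) ∈ S' ×ˢ ({true} : Set Bool) ∧ ∀ j < k, (x (a + 1 + j)).2 = false)})
      (∫ x in S, (imhAcceptMass q w x).toReal * (imhJump q w x).real S' ∂π) := by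
  have hw : Measurable w := Fact.out
  have heq : ∫ x in S, (imhAcceptMass q w x).toReal * (imhJump q w x).real S' ∂π
      = ∫ x in S, ∫ y in S', imhAccept w x y ∂q ∂π :=
    integral_congr_ae (ae_of_all _ fun x => by
      beta_reduce
      rw [real_imhJump_apply hw hw0 x S', mul_div_assoc',
        mul_div_cancel_left₀ _ (toReal_imhAcceptMass_pos hw hw0 x).ne'])
  rw [heq]
  exact hasSum_acceptedExit_prob hw0 hinv hS hS' a

/-! ### §4 The lattice instance -/

section Lattice
open Literature.MathematicalPhysics.QuantumFieldTheory
open Literature.MathematicalPhysics.QuantumFieldTheory.Luscher2010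
open Summit.Ventures.LatticeQCDFlow.TrivializingMaps
open scoped Matrix Matrix.Norms.Frobenius ContDiff
variable {d L n : ℕ} [NeZero L]

/-- **THE ACCEPTED CONFIGURATIONS OF AN EXACT FLOW SAMPLER ON `SU(n)^E` FORM A UNIFORMLY ERGODIC,
REVERSIBLE, POSITIVELY CORRELATED CHAIN — every volume** (hypotheses of `flowSampler_exact_doeblin`;
model `q = (Φ 1)_* D[V]`, `π` = Boltzmann): a measurable `w` with `w · q = π` such that `J̃` is
Markov and `imhTilt`-reversible, `ā = ∫ α dπ ≥ e^{−2δ}`, `J̃(U, ·) ≥ ā · imhTilt` for every `U`, and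
for bounded measurable accepted-row-centred `f` and every lag `t`:
`0 ≤ autocov J̃ imhTilt f t ≤ (1 − ā)ᵗ ∫ f² d(imhTilt)`, `τ_int(J̃, f) ≤ 1/ā − 1/2`. -/
theorem flowSampler_jump_doeblin (B : SuBasis n)
    {S : AmbConfig d L n → ℝ} (hS : ContDiff ℝ ∞ S) {F : ℝ → AmbConfig d L n → ℝ}
    (hF : ContDiff ℝ ∞ fun p : ℝ × AmbConfig d L n => F p.1 p.2)
    {Φ} (hΦ : IsFlowMap (fun t W => -linkGrad B (F t) W) Φ) {c : ℝ → ℝ} {δ : ℝ}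
    (hδ : ∀ t ∈ Set.Icc (0 : ℝ) 1, ∀ U : GaugeConfig d L (Matrix.specialUnitaryGroup (Fin n) ℂ),
      |luscherL B S t (F t) (WilsonFlow.coeConfig U) - S (WilsonFlow.coeConfig U) - c t| ≤ δ)
    (q : Measure (GaugeConfig d L (Matrix.specialUnitaryGroup (Fin n) ℂ))) [IsProbabilityMeasure q]
    (hq : q = Measure.map (Φ 1) (trivialMeasure (Matrix.specialUnitaryGroup (Fin n) ℂ) d L))
    {π : Measure (GaugeConfig d L (Matrix.specialUnitaryGroup (Fin n) ℂ))} [IsProbabilityMeasure π]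
    (hπB : π = boltzmannMeasure fun U => S (WilsonFlow.coeConfig U)) :
    ∃ w : GaugeConfig d L (Matrix.specialUnitaryGroup (Fin n) ℂ) → ℝ, Measurable w ∧
      (q.withDensity fun U => ENNReal.ofReal (w U)) = π ∧
      IsMarkovKernel (imhJump q w) ∧ Kernel.IsReversible (imhJump q w) (imhTilt q w π) ∧
      ENNReal.ofReal (Real.exp (-(2 * δ))) ≤ ∫⁻ U, imhAcceptMass q w U ∂π ∧
      (∀ (U : GaugeConfig d L (Matrix.specialUnitaryGroup (Fin n) ℂ))
        {A : Set (GaugeConfig d L (Matrix.specialUnitaryGroup (Fin n) ℂ))}, MeasurableSet A →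
        (∫⁻ V, imhAcceptMass q w V ∂π) * imhTilt q w π A ≤ imhJump q w U A) ∧
      ∀ (f : GaugeConfig d L (Matrix.specialUnitaryGroup (Fin n) ℂ) → ℝ), Measurable f →
        ∀ {C : ℝ}, (∀ U, |f U| ≤ C) → ∫ U, (imhAcceptMass q w U).toReal * f U ∂π = 0 →
        ∀ t : ℕ, 0 ≤ autocov (imhJump q w) (imhTilt q w π) f t ∧
          |autocov (imhJump q w) (imhTilt q w π) f t|
            ≤ (1 - (∫⁻ U, imhAcceptMass q w U ∂π).toReal) ^ t * ∫ U, f U ^ 2 ∂(imhTilt q w π) ∧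
          tauInt (fun s => autocov (imhJump q w) (imhTilt q w π) f s
              / autocov (imhJump q w) (imhTilt q w π) f 0)
            ≤ 1 / (∫⁻ U, imhAcceptMass q w U ∂π).toReal - 1 / 2 := by
  subst hπB
  obtain ⟨w, hw, hlo, -, hπ, -, hα, -⟩ := flowSampler_exact_doeblin B hS hF hΦ hδ q hq
  have hw0 : ∀ U, 0 < w U := fun U => (Real.exp_pos _).trans_le (hlo U)
  refine ⟨w, hw, hπ, isMarkovKernel_imhJump hw hw0, imhJump_isReversible hw hw0 hπ, ?_,
    fun U A hA => imhJump_doeblin hw hw0 hπ U hA, fun f hf C hC hf0 t =>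
      ⟨autocov_imhJump_nonneg hw hw0 hπ hf hC t, abs_autocov_imhJump_le hw hw0 hπ hf hC hf0 t,
        tauInt_imhJump_le hw hw0 hπ hf hC hf0⟩⟩
  refine Eq.trans_le ?_ (lintegral_mono hα)
  rw [lintegral_const, measure_univ, mul_one]

end Lattice

end Summit.Ventures.LatticeQCDFlow.Scoring
end
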